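import Summits.AtomisticToContinuum.BoseEinsteinCondensation.Theorems.BECConjugateDominationHardCoreExtensionNearMinTowerNecessityCore
import Summits.AtomisticToContinuum.BoseEinsteinCondensation.Theorems.BECConjugateDominationHardCoreExtensionNearMinTowerSmooth
import Summits.AtomisticToContinuum.BoseEinsteinCondensation.Theorems.BECConjugateDominationHardCoreExtensionMaxFormApproximationFiniteRange
import Summits.AtomisticToContinuum.BoseEinsteinCondensation.Theorems.BECConjugateDominationHardCoreExtensionNearMinTowerAE
import Summits.AtomisticToContinuum.BoseEinsteinCondensation.Theses.BECPeriodicReduction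
import HarnessLib

/-!
# Necessity at hard cores: T★(v) ⟺ PeriodicBEC(v) for EVERY admissible potential
# (crux `BECConjugateDomination.HardCoreExtension`, stmt-AtomisticToContinuum-11786 — line `near-minimiser-slack-transfer`, lead c7)

Sequel of `…NearMinTowerNecessityCore.lean`, fed with the landed worker stub S-B `stub_maxFormApproximationFiniteRange`
(B. Simon's maximal = minimal form for finite-range pair potentials WITH hard cores: the normalised Bose `C¹` core is
strongly dense in the unit sphere of the maximal form domain, for every repulsive finite-range `v`).

* `towerBEC_of_periodicBEC` — `PeriodicBEC(v)` ⇒ near-minimiser BEC along every monotone measurable tower of minorants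
  `wₙ ↑ v`, slack level-uniform, fraction halved, for EVERY admissible `v`;
* `nearMinimiserTowerBEC_iff_periodicBEC` — the registered thermodynamic stub T★(v) of the line is EQUIVALENT to near-minimiser
  periodic BEC of `v` (the hypothesis of `BoundaryTransferWeak v`): the residue of the crux after this line is EXACTLY the
  periodic conjunct, potential by potential;
* `smoothTowerBEC_iff_periodicBEC_hardCore` — hard-sphere periodic BEC ⟺ height-uniform near-minimiser BEC along the explicit
  smooth-class tower `t·solidBump a` (the route's currency).

So the entire content of "extension to hard cores" (`HardCoreExtension`) is the level-uniformity of the constants along an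
approximating tower — the one feature its pointwise antecedent does not provide (Disproof §5).

References: E. H. Lieb, R. Seiringer, J. P. Solovej, J. Yngvason, *The Mathematics of the Bose Gas and its Condensation*
(2005), §1.2 (1.19), Ch. 2 (after (2.1)), Ch. 5 p. 42; B. Simon, J. Operator Theory 1 (1979) 37–47; M. Reed, B. Simon,
*Methods of Modern Mathematical Physics IV* (1978), Thm XIII.64.
-/

noncomputable section

namespace Summit.AtomisticToContinuum.BoseEinsteinCondensation.Cruxes.HardCoreExtension.NearMinTower

open MeasureTheory Filter
open scoped ENNReal NNReal Topology
open Literature.MathematicalPhysics.QuantumManyBody.BoseGas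
open Summit.AtomisticToContinuum.BoseEinsteinCondensation.Theses.BECConjugateDomination

/-- **Necessity (thermodynamic form; modulo S-B): `PeriodicBEC(v)` ⇒ near-minimiser BEC along every monotone
measurable tower of minorants `wₙ ↑ v`, slack level-uniform, fraction halved**, for EVERY repulsive finite-range `v` (hard
cores included: strong density is S-B `stub_maxFormApproximationFiniteRange`). With the transfer
`periodicBEC_of_minorantTowerBEC` (landed) + the tower energy convergence (W-A, landed), tower BEC and `PeriodicBEC(v)` are
EQUIVALENT for every admissible `v` and every such tower. [cite: LSSY2005, §1.2 (1.19) and Ch. 5 p. 42] -/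
theorem towerBEC_of_periodicBEC :
    ∀ v : ℝ → ℝ≥0∞, IsRepulsiveFiniteRange v → ∀ w : ℕ → ℝ → ℝ≥0∞, (∀ n, Measurable (w n)) →
      (∀ n r, w n r ≤ w (n + 1) r) → (∀ r, ⨆ n, w n r = v r) →
      (∃ ρ₀ : ℝ, 0 < ρ₀ ∧ ∀ ρ : ℝ, 0 < ρ → ρ < ρ₀ → ∃ c : ℝ, 0 < c ∧ ∀ᶠ N : ℕ in atTop,
        ∃ δ : ℝ≥0∞, 0 < δ ∧ ∀ Ψ : PeriodicTrialState N (sideLength ρ N),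
          periodicEnergy v Ψ ≤ periodicGroundStateEnergy v N (sideLength ρ N) + δ →
            ENNReal.ofReal (c * N) ≤ condensateOccupation N (sideLength ρ N) Ψ.ψ) →
      ∃ ρ₀ : ℝ, 0 < ρ₀ ∧ ∀ ρ : ℝ, 0 < ρ → ρ < ρ₀ → ∃ c : ℝ, 0 < c ∧ ∀ᶠ N : ℕ in atTop,
        ∃ δ : ℝ≥0∞, 0 < δ ∧ ∃ n₀ : ℕ, ∀ n : ℕ, n₀ ≤ n →
          ∀ Ψ : PeriodicTrialState N (sideLength ρ N),
            periodicEnergy (w n) Ψ ≤ periodicGroundStateEnergy (w n) N (sideLength ρ N) + δ →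
              ENNReal.ofReal (c * N) ≤ condensateOccupation N (sideLength ρ N) Ψ.ψ :=
  fun v hv w hwm hmono hsup hP => towerBEC_of_periodicBEC_of_approx v hv w hwm hmono hsup
    (fun N L hL => stub_maxFormApproximationFiniteRange v hv N L hL) hP

/-- **T★(v) ⟺ `PeriodicBEC(v)` for every admissible `v`** (S-A, S-B landed; `→` is the landed transfer): the
registered residue of this line is exactly the periodic conjunct, potential by potential; in particular hard-sphere
periodic BEC ⟺ height-uniform soft-sphere near-minimiser BEC. [cite: LSSY2005, §1.2 (1.19) and Ch. 5 p. 42] -/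
theorem nearMinimiserTowerBEC_iff_periodicBEC (v : ℝ → ℝ≥0∞) (hv : IsRepulsiveFiniteRange v) :
    (∃ ρ₀ : ℝ, 0 < ρ₀ ∧ ∀ ρ : ℝ, 0 < ρ → ρ < ρ₀ → ∃ c : ℝ, 0 < c ∧ ∀ᶠ N : ℕ in atTop,
        ∃ δ : ℝ≥0∞, 0 < δ ∧ ∃ n₀ : ℕ, ∀ n : ℕ, n₀ ≤ n →
          ∀ Ψ : PeriodicTrialState N (sideLength ρ N),
            periodicEnergy (fun r => min (v r) (n : ℝ≥0∞)) Ψ ≤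
                periodicGroundStateEnergy (fun r => min (v r) (n : ℝ≥0∞)) N (sideLength ρ N) + δ →
              ENNReal.ofReal (c * N) ≤ condensateOccupation N (sideLength ρ N) Ψ.ψ) ↔
    (∃ ρ₀ : ℝ, 0 < ρ₀ ∧ ∀ ρ : ℝ, 0 < ρ → ρ < ρ₀ → ∃ c : ℝ, 0 < c ∧ ∀ᶠ N : ℕ in atTop,
      ∃ δ : ℝ≥0∞, 0 < δ ∧ ∀ Ψ : PeriodicTrialState N (sideLength ρ N),
        periodicEnergy v Ψ ≤ periodicGroundStateEnergy v N (sideLength ρ N) + δ →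
          ENNReal.ofReal (c * N) ≤ condensateOccupation N (sideLength ρ N) Ψ.ψ) :=
  ⟨periodicBEC_of_nearMinimiserTowerBEC v hv,
    towerBEC_of_periodicBEC v hv (fun n r => min (v r) (n : ℝ≥0∞)) (fun _ => hv.1.min measurable_const)
      (fun n r => min_le_min le_rfl (by exact_mod_cast Nat.le_succ n)) (iSup_truncPotential v)⟩

/-- **Hard-sphere periodic BEC ⟺ height-uniform near-minimiser BEC along the explicit SMOOTH-CLASS tower** of
`stub_smoothTowerHardCore`: the smooth currency is also EXACTLY equivalent. [cite: LSSY2005, Ch. 2 (after (2.1)) and Ch. 5 p. 42] -/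
theorem smoothTowerBEC_iff_periodicBEC_hardCore {a : ℝ} (ha : 0 < a) :
    (∀ w : ℕ → ℝ → ℝ≥0∞,
      (∀ t, IsRepulsiveFiniteRange (w t) ∧ (∀ r, w t r ≠ ⊤) ∧
        ContDiff ℝ 2 (fun x : Space => (w t ‖x‖).toReal) ∧
        (∃ Cₑ : ℝ, ∀ x : Space,
          ‖iteratedFDeriv ℝ 2 (fun x : Space => (w t ‖x‖).toReal) x‖ ≤ Cₑ * Real.sqrt ((w t ‖x‖).toReal)) ∧
        (∀ r, a < r → w t r = 0)) →
      (∀ t r, w t r ≤ w (t + 1) r) → (∀ r, ⨆ t, w t r = hardCorePotential a r) →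
      ∃ ρ₀ : ℝ, 0 < ρ₀ ∧ ∀ ρ : ℝ, 0 < ρ → ρ < ρ₀ → ∃ c : ℝ, 0 < c ∧ ∀ᶠ N : ℕ in atTop,
        ∃ δ : ℝ≥0∞, 0 < δ ∧ ∃ t₀ : ℕ, ∀ t : ℕ, t₀ ≤ t →
          ∀ Ψ : PeriodicTrialState N (sideLength ρ N),
            periodicEnergy (w t) Ψ ≤ periodicGroundStateEnergy (w t) N (sideLength ρ N) + δ →
              ENNReal.ofReal (c * N) ≤ condensateOccupation N (sideLength ρ N) Ψ.ψ) ↔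
    (∃ ρ₀ : ℝ, 0 < ρ₀ ∧ ∀ ρ : ℝ, 0 < ρ → ρ < ρ₀ → ∃ c : ℝ, 0 < c ∧ ∀ᶠ N : ℕ in atTop,
      ∃ δ : ℝ≥0∞, 0 < δ ∧ ∀ Ψ : PeriodicTrialState N (sideLength ρ N),
        periodicEnergy (hardCorePotential a) Ψ ≤ periodicGroundStateEnergy (hardCorePotential a) N (sideLength ρ N) + δ →
          ENNReal.ofReal (c * N) ≤ condensateOccupation N (sideLength ρ N) Ψ.ψ) :=
  ⟨periodicBEC_of_smoothTowerBEC_hardCore a ha, fun hP w hw hmono hsup =>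
    towerBEC_of_periodicBEC _ (isRepulsiveFiniteRange_hardCorePotential a) w (fun t => (hw t).1.1) hmono hsup hP⟩

/-- **The residue of the crux IS the periodic conjunct.** `(∀ v admissible, T★(v))` — the single registered obligation of
the line's landed composition `hardCoreExtension_of_nearMinimiserTowerBEC` — is EQUIVALENT to near-minimiser periodic BEC for
every repulsive finite-range potential, i.e. VERBATIM the decl `Summit.…Theses.BECPeriodicReduction.PeriodicBEC`
(stmt-AtomisticToContinuum-0826; its smooth-class restriction is this route's target `SmoothPeriodicBEC`, stmt-11783). Hence
`HardCoreExtension` is subsumed by stmt-0826 ∧ stmt-0827 and no line through approximating towers can make it cheaper.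
[cite: LSSY2005, Ch. 5 p. 42] -/
theorem towerBECResidue_iff_periodicConjunct :
    (∀ v : ℝ → ℝ≥0∞, IsRepulsiveFiniteRange v →
      ∃ ρ₀ : ℝ, 0 < ρ₀ ∧ ∀ ρ : ℝ, 0 < ρ → ρ < ρ₀ → ∃ c : ℝ, 0 < c ∧ ∀ᶠ N : ℕ in atTop,
        ∃ δ : ℝ≥0∞, 0 < δ ∧ ∃ n₀ : ℕ, ∀ n : ℕ, n₀ ≤ n →
          ∀ Ψ : PeriodicTrialState N (sideLength ρ N),
            periodicEnergy (fun r => min (v r) (n : ℝ≥0∞)) Ψ ≤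
                periodicGroundStateEnergy (fun r => min (v r) (n : ℝ≥0∞)) N (sideLength ρ N) + δ →
              ENNReal.ofReal (c * N) ≤ condensateOccupation N (sideLength ρ N) Ψ.ψ) ↔
    (∀ v : ℝ → ℝ≥0∞, IsRepulsiveFiniteRange v →
      ∃ ρ₀ : ℝ, 0 < ρ₀ ∧ ∀ ρ : ℝ, 0 < ρ → ρ < ρ₀ → ∃ c : ℝ, 0 < c ∧ ∀ᶠ N : ℕ in atTop,
        ∃ δ : ℝ≥0∞, 0 < δ ∧ ∀ Ψ : PeriodicTrialState N (sideLength ρ N),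
          periodicEnergy v Ψ ≤ periodicGroundStateEnergy v N (sideLength ρ N) + δ →
            ENNReal.ofReal (c * N) ≤ condensateOccupation N (sideLength ρ N) Ψ.ψ) :=
  forall₂_congr fun v hv => nearMinimiserTowerBEC_iff_periodicBEC v hv

/-- **… and BY NAME**: the residue of the crux ⟺ `BECPeriodicReduction.PeriodicBEC` (stmt-AtomisticToContinuum-0826).
[cite: LSSY2005, Ch. 5 p. 42] -/
theorem towerBECResidue_iff_PeriodicBEC :
    (∀ v : ℝ → ℝ≥0∞, IsRepulsiveFiniteRange v →
      ∃ ρ₀ : ℝ, 0 < ρ₀ ∧ ∀ ρ : ℝ, 0 < ρ → ρ < ρ₀ → ∃ c : ℝ, 0 < c ∧ ∀ᶠ N : ℕ in atTop,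
        ∃ δ : ℝ≥0∞, 0 < δ ∧ ∃ n₀ : ℕ, ∀ n : ℕ, n₀ ≤ n →
          ∀ Ψ : PeriodicTrialState N (sideLength ρ N),
            periodicEnergy (fun r => min (v r) (n : ℝ≥0∞)) Ψ ≤
                periodicGroundStateEnergy (fun r => min (v r) (n : ℝ≥0∞)) N (sideLength ρ N) + δ →
              ENNReal.ofReal (c * N) ≤ condensateOccupation N (sideLength ρ N) Ψ.ψ) ↔
    Summit.AtomisticToContinuum.BoseEinsteinCondensation.Theses.BECPeriodicReduction.PeriodicBEC := by
  unfold Summit.AtomisticToContinuum.BoseEinsteinCondensation.Theses.BECPeriodicReduction.PeriodicBEC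
  exact towerBECResidue_iff_periodicConjunct

/-! ## T★ on the a.e.-free class (unconditional) -/

/-- **T★ holds for every potential a.e.-equal to zero** (e.g. `⊤·1_{ℚ}`, a hard set of radii of measure zero): the free gas
(`nearMinimiserTowerBEC_zero`) transported along the a.e.-class (`nearMinimiserTowerBEC_congr_ae`). [cite: LSSY2005, §1.2 (1.19)] -/
theorem nearMinimiserTowerBEC_of_ae_zero {v : ℝ → ℝ≥0∞} (h : ∀ᵐ x : Space, v ‖x‖ = 0) :
    ∃ ρ₀ : ℝ, 0 < ρ₀ ∧ ∀ ρ : ℝ, 0 < ρ → ρ < ρ₀ → ∃ c : ℝ, 0 < c ∧ ∀ᶠ N : ℕ in atTop,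
        ∃ δ : ℝ≥0∞, 0 < δ ∧ ∃ n₀ : ℕ, ∀ n : ℕ, n₀ ≤ n →
          ∀ Ψ : PeriodicTrialState N (sideLength ρ N),
            periodicEnergy (fun r => min (v r) (n : ℝ≥0∞)) Ψ ≤
                periodicGroundStateEnergy (fun r => min (v r) (n : ℝ≥0∞)) N (sideLength ρ N) + δ →
              ENNReal.ofReal (c * N) ≤ condensateOccupation N (sideLength ρ N) Ψ.ψ :=
  (nearMinimiserTowerBEC_congr_ae v 0 (by simpa using h)).2 nearMinimiserTowerBEC_zero

/-! ## The consumer-facing smooth currency: ONE smooth tower suffices -/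

/-- **Hard-sphere periodic BEC from near-minimiser BEC along ANY ONE smooth-class tower** (consumer-facing form of the smooth
currency: a route exhibits its own monotone smooth-class tower `w t ↑ hardCorePotential a` — e.g. `t·solidBump a` — and proves
height-uniform near-minimiser BEC along it; W-A energy convergence + the slack transfer do the rest). [cite: LSSY2005, Ch. 2 (after (2.1)) and Ch. 5 p. 42] -/
theorem periodicBEC_of_exists_smoothTowerBEC_hardCore {a : ℝ}
    (hT : ∃ w : ℕ → ℝ → ℝ≥0∞,
      (∀ t, IsRepulsiveFiniteRange (w t) ∧ (∀ r, w t r ≠ ⊤) ∧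
        ContDiff ℝ 2 (fun x : Space => (w t ‖x‖).toReal) ∧
        (∃ Cₑ : ℝ, ∀ x : Space,
          ‖iteratedFDeriv ℝ 2 (fun x : Space => (w t ‖x‖).toReal) x‖ ≤ Cₑ * Real.sqrt ((w t ‖x‖).toReal)) ∧
        (∀ r, a < r → w t r = 0)) ∧
      (∀ t r, w t r ≤ w (t + 1) r) ∧ (∀ r, ⨆ t, w t r = hardCorePotential a r) ∧
      ∃ ρ₀ : ℝ, 0 < ρ₀ ∧ ∀ ρ : ℝ, 0 < ρ → ρ < ρ₀ → ∃ c : ℝ, 0 < c ∧ ∀ᶠ N : ℕ in atTop,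
        ∃ δ : ℝ≥0∞, 0 < δ ∧ ∃ t₀ : ℕ, ∀ t : ℕ, t₀ ≤ t →
          ∀ Ψ : PeriodicTrialState N (sideLength ρ N),
            periodicEnergy (w t) Ψ ≤ periodicGroundStateEnergy (w t) N (sideLength ρ N) + δ →
              ENNReal.ofReal (c * N) ≤ condensateOccupation N (sideLength ρ N) Ψ.ψ) :
    ∃ ρ₀ : ℝ, 0 < ρ₀ ∧ ∀ ρ : ℝ, 0 < ρ → ρ < ρ₀ → ∃ c : ℝ, 0 < c ∧ ∀ᶠ N : ℕ in atTop,
      ∃ δ : ℝ≥0∞, 0 < δ ∧ ∀ Ψ : PeriodicTrialState N (sideLength ρ N),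
        periodicEnergy (hardCorePotential a) Ψ ≤ periodicGroundStateEnergy (hardCorePotential a) N (sideLength ρ N) + δ →
          ENNReal.ofReal (c * N) ≤ condensateOccupation N (sideLength ρ N) Ψ.ψ := by
  obtain ⟨w, hw, hmono, hsup, hBEC⟩ := hT
  have hv := isRepulsiveFiniteRange_hardCorePotential a
  have hwv : ∀ t r, w t r ≤ hardCorePotential a r := fun t r => (hsup r) ▸ le_iSup (fun t => w t r) t
  exact periodicBEC_of_minorantTowerBEC _ hv w hwv
    (fun N L hL hE ε hε => stub_towerEnergyConvergence _ hv w (fun t => (hw t).1.1) hmono hsup N L hL hE ε hε) hBEC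

end Summit.AtomisticToContinuum.BoseEinsteinCondensation.Cruxes.HardCoreExtension.NearMinTower

end
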